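import Summits.AnomalousDissipation.AnomalousDissipation.Theses.StirringSphere
import Summits.AnomalousDissipation.AnomalousDissipation.Theorems.EnsembleCeiling.Negative.BeltramiFat

/-!
# Negative knowledge for the crux `BoundedSphereStatistics` (stmt-AnomalousDissipation-17145):
# the ABC direction of the stirring sphere, and the universal strengthening is false

Crux `StirringSphere.BoundedSphereStatistics` (route `AnomalousDissipation/StirringSphere`, rank 3) asks
for `E, ν₀ > 0` such that every unit `c ∈ ℝ³` and every `ν ∈ (0, ν₀)` admit SOME Foias–Prodi stationary
statistical solution of `NS_ν(f_c)`, `f_c = Σᵢ cᵢ bᵢ` on the explicit stirring sphere, of mean energy `≤ E`.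
Refuter crux-attack seat `refuter-rattack-stmt-AnomalousDissipation-17145-0`, 2026-08-17.

This file certifies two facts used by every seat of the crux:

* `sphereForce_cPlus_eq_abc` — at the unit direction `c₊ = (e₀ + e₁)/√2` the sphere force
  `f_{c₊} = (b₀ + b₁)/√2` IS the Arnold–Beltrami–Childress force with `A = B = C = 1/√2`, in the
  `realTrigPoly` normal form of `Theorems.EnsembleCeiling.Negative.BeltramiFat` (frequencies `e₃, e₁, e₂`,
  helical amplitudes `A(-i,1,0)`, `B(0,-i,1)`, `C(1,0,-i)`): the "laminar-prone direction" of the crux's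
  why-might-fail lies ON the sphere.
* `not_boundedSphereStatistics_forall` — the natural strengthening of the crux in which the existential
  `∃ μ` is replaced by a CEILING over all stationary statistical solutions (`∀ μ, … → ensembleEnergy μ ≤ E`)
  is FALSE: at `c₊` the laminar ABC Dirac masses `δ_{f_{c₊}/(4π²ν)}` are stationary statistical solutions of
  energy `(3/2)/(16π⁴ν²)` (`BeltramiFat.not_ceiling_abc`). Any proof of the crux must SELECT statistics;
  nothing that bounds all of them can work on this sphere.

Nothing here asserts a Theses statement (the crux itself is untouched: it is existential in `μ`).
-/

noncomputable section

open MeasureTheory UnitAddTorus Matrix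
open scoped InnerProductSpace ENNReal ComplexConjugate

namespace Summit.AnomalousDissipation.AnomalousDissipation.Theorems.BoundedSphereStatistics.Negative

open Literature.Analysis.FunctionSpaces Literature.Analysis.FluidPDE
open Summit.AnomalousDissipation.AnomalousDissipation.Theorems.EnsembleCeiling.Negative

/-- `c₊ = (e₀ + e₁)/√2` is a unit vector. -/
theorem norm_cPlus : ‖(WithLp.toLp 2 ![(Real.sqrt 2)⁻¹, (Real.sqrt 2)⁻¹, 0] : EuclideanSpace ℝ (Fin 3))‖ = 1 := by
  rw [EuclideanSpace.norm_eq]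
  simp only [Fin.sum_univ_three]
  simp only [Matrix.cons_val_zero, Matrix.cons_val_one, Matrix.cons_val_two,
    Matrix.head_cons, Matrix.tail_cons, Real.norm_eq_abs, sq_abs, inv_pow,
    Real.sq_sqrt (show (0 : ℝ) ≤ 2 by norm_num)]
  norm_num

/-- **The ABC direction of the stirring sphere.** At `c₊ = (e₀ + e₁)/√2` the sphere force
`Σᵢ (c₊)ᵢ bᵢ = (b₀ + b₁)/√2` equals the ABC mode sum of `BeltramiFat` with `A = B = C = 1/√2`:
`b₀ + b₁ = (sin 2πx₃ + cos 2πx₂, sin 2πx₁ + cos 2πx₃, sin 2πx₂ + cos 2πx₁) = ABC(1,1,1)` (mode `e₃` carries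
`(sin 2πx₃, cos 2πx₃, 0) = Re(e_{e₃}(-i,1,0))`, and cyclically). -/
theorem sphereForce_cPlus_eq_abc :
    (fun x : UnitAddTorus (Fin 3) => ∑ i : Fin 3, (WithLp.toLp 2 ![(Real.sqrt 2)⁻¹, (Real.sqrt 2)⁻¹, 0] : EuclideanSpace ℝ (Fin 3)) i • (![(fun x : UnitAddTorus (Fin 3) => (Literature.Analysis.FluidPDE.Torus.stokesMode (Pi.single (2 : Fin 3) (1 : ℤ)) (EuclideanSpace.single (0 : Fin 3) (1 : ℝ)) false x + Literature.Analysis.FluidPDE.Torus.stokesMode (Pi.single (0 : Fin 3) (1 : ℤ)) (EuclideanSpace.single (1 : Fin 3) (1 : ℝ)) false x + Literature.Analysis.FluidPDE.Torus.stokesMode (Pi.single (1 : Fin 3) (1 : ℤ)) (EuclideanSpace.single (2 : Fin 3) (1 : ℝ)) false x : EuclideanSpace ℝ (Fin 3))), (fun x : UnitAddTorus (Fin 3) => (Literature.Analysis.FluidPDE.Torus.stokesMode (Pi.single (1 : Fin 3) (1 : ℤ)) (EuclideanSpace.single (0 : Fin 3) (1 : ℝ)) true x + Literature.Analysis.FluidPDE.Torus.stokesMode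 (Pi.single (2 : Fin 3) (1 : ℤ)) (EuclideanSpace.single (1 : Fin 3) (1 : ℝ)) true x + Literature.Analysis.FluidPDE.Torus.stokesMode (Pi.single (0 : Fin 3) (1 : ℤ)) (EuclideanSpace.single (2 : Fin 3) (1 : ℝ)) true x : EuclideanSpace ℝ (Fin 3))), (fun x : UnitAddTorus (Fin 3) => (Literature.Analysis.FluidPDE.Torus.stokesMode ![(0 : ℤ), 1, 1] (EuclideanSpace.single (0 : Fin 3) (1 : ℝ)) false x + Literature.Analysis.FluidPDE.Torus.stokesMode ![(1 : ℤ), 0, 1] (EuclideanSpace.single (1 : Fin 3) (1 : ℝ)) false x + Literature.Analysis.FluidPDE.Torus.stokesMode ![(1 : ℤ), 1, 0] (EuclideanSpace.single (2 : Fin 3) (1 : ℝ)) false x : EuclideanSpace ℝ (Fin 3)))] : Fin 3 → UnitAddTorus (Fin 3) → EuclideanSpace ℝ (Fin 3)) i x) =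
      ∑ mm, Torus.realTrigPoly {(![![0, 0, 1], ![1, 0, 0], ![0, 1, 0]] : Fin 3 → (Fin 3 → ℤ)) mm} (fun _ => (![(((Real.sqrt 2)⁻¹ : ℝ) : ℂ) • (WithLp.toLp 2 ![-Complex.I, 1, 0] : EuclideanSpace ℂ (Fin 3)),
          (((Real.sqrt 2)⁻¹ : ℝ) : ℂ) • (WithLp.toLp 2 ![0, -Complex.I, 1] : EuclideanSpace ℂ (Fin 3)),
          (((Real.sqrt 2)⁻¹ : ℝ) : ℂ) • (WithLp.toLp 2 ![1, 0, -Complex.I] : EuclideanSpace ℂ (Fin 3))] : Fin 3 → EuclideanSpace ℂ (Fin 3)) mm) := by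
  have h0 : (Pi.single (0 : Fin 3) (1 : ℤ) : Fin 3 → ℤ) = ![1, 0, 0] := by decide
  have h1 : (Pi.single (1 : Fin 3) (1 : ℤ) : Fin 3 → ℤ) = ![0, 1, 0] := by decide
  have h2 : (Pi.single (2 : Fin 3) (1 : ℤ) : Fin 3 → ℤ) = ![0, 0, 1] := by decide
  have hne : Real.sqrt 2 ≠ 0 := by positivity
  have hsq : Real.sqrt 2 * Real.sqrt 2 = 2 := Real.mul_self_sqrt (by norm_num)
  have hs2 : (Real.sqrt 2)⁻¹ = Real.sqrt 2 / 2 :=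
    calc (Real.sqrt 2)⁻¹ = (Real.sqrt 2)⁻¹ * (Real.sqrt 2 * Real.sqrt 2) / 2 := by
          rw [hsq, mul_div_assoc, div_self (two_ne_zero' ℝ), mul_one]
      _ = Real.sqrt 2 / 2 := by rw [← mul_assoc, inv_mul_cancel₀ hne, one_mul]
  funext x
  simp only [h0, h1, h2]
  rw [Finset.sum_apply]
  simp only [Fin.sum_univ_three, Matrix.cons_val_zero, Matrix.cons_val_one, Matrix.cons_val_two,
    Matrix.head_cons, Matrix.tail_cons, Torus.realTrigPoly_singleton_apply, Torus.stokesMode_apply]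
  ext j
  fin_cases j <;>
    simp [EuclideanSpace.realPart_apply, Complex.mul_re, Complex.mul_im, hs2] <;> ring

/-- **The universal strengthening of `BoundedSphereStatistics` is false.** Replacing `∃ μ, stationary ∧
integrable ∧ energy ≤ E` by a ceiling `∀ μ, stationary → integrable → energy ≤ E` over the whole sphere
gives a false statement: at the ABC direction `c₊` the laminar Dirac masses have energy
`(3/2)/(16π⁴ν²) → ∞` (`BeltramiFat.not_ceiling_abc` with `A = B = C = 1/√2`, transported along
`sphereForce_cPlus_eq_abc`). -/
theorem not_boundedSphereStatistics_forall :
    ¬ (∀ b : Fin 3 → UnitAddTorus (Fin 3) → EuclideanSpace ℝ (Fin 3), b = (![(fun x : UnitAddTorus (Fin 3) => (Literature.Analysis.FluidPDE.Torus.stokesMode (Pi.single (2 : Fin 3) (1 : ℤ)) (EuclideanSpace.single (0 : Fin 3) (1 : ℝ)) false x + Literature.Analysis.FluidPDE.Torus.stokesMode (Pi.single (0 : Fin 3) (1 : ℤ)) (EuclideanSpace.single (1 : Fin 3) (1 : ℝ)) false x + Literature.Analysis.FluidPDE.Torus.stokesMode (Pi.single (1 : Fin 3) (1 : ℤ)) (EuclideanSpace.single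 (2 : Fin 3) (1 : ℝ)) false x : EuclideanSpace ℝ (Fin 3))), (fun x : UnitAddTorus (Fin 3) => (Literature.Analysis.FluidPDE.Torus.stokesMode (Pi.single (1 : Fin 3) (1 : ℤ)) (EuclideanSpace.single (0 : Fin 3) (1 : ℝ)) true x + Literature.Analysis.FluidPDE.Torus.stokesMode (Pi.single (2 : Fin 3) (1 : ℤ)) (EuclideanSpace.single (1 : Fin 3) (1 : ℝ)) true x + Literature.Analysis.FluidPDE.Torus.stokesMode (Pi.single (0 : Fin 3) (1 : ℤ)) (EuclideanSpace.single (2 : Fin 3) (1 : ℝ)) true x : EuclideanSpace ℝ (Fin 3))), (fun x : UnitAddTorus (Fin 3) => (Literature.Analysis.FluidPDE.Torus.stokesMode ![(0 : ℤ), 1, 1] (EuclideanSpace.single (0 : Fin 3) (1 : ℝ)) false x + Literature.Analysis.FluidPDE.Torus.stokesMode ![(1 : ℤ), 0, 1] (EuclideanSpace.single (1 : Fin 3) (1 : ℝ)) false x + Literature.Analysis.FluidPDE.Torus.stokesMode ![(1 : ℤ), 1, 0] (EuclideanSpace.single (2 : Fin 3) (1 : ℝ)) false x : EuclideanSpace ℝ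 (Fin 3)))] : Fin 3 → UnitAddTorus (Fin 3) → EuclideanSpace ℝ (Fin 3)) →
      ∃ E ν₀ : ℝ, 0 < E ∧ 0 < ν₀ ∧ ∀ c : EuclideanSpace ℝ (Fin 3), ‖c‖ = 1 → ∀ ν : ℝ, 0 < ν → ν < ν₀ →
        ∀ μ : MeasureTheory.Measure (Literature.Analysis.FunctionSpaces.Torus.energySpace (Fin 3)),
          Literature.Analysis.FluidPDE.Torus.IsStationaryStatisticalSolution ν
              (fun x : UnitAddTorus (Fin 3) => ∑ i : Fin 3, c i • b i x) μ →
            MeasureTheory.Integrable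
                (fun u : Literature.Analysis.FunctionSpaces.Torus.energySpace (Fin 3) => ‖u‖ ^ 2) μ →
              Literature.Analysis.FluidPDE.Torus.ensembleEnergy μ ≤ E) := by
  intro h
  obtain ⟨E, ν₀, -, hν₀, H⟩ := h _ rfl
  have hs : (Real.sqrt 2)⁻¹ ≠ (0 : ℝ) := by positivity
  refine not_ceiling_abc (A := (Real.sqrt 2)⁻¹) (B := (Real.sqrt 2)⁻¹) (C := (Real.sqrt 2)⁻¹) (Or.inl hs)
    ⟨E, ν₀, hν₀, fun ν hν hνlt μ hμ hint => ?_⟩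
  have key := H (WithLp.toLp 2 ![(Real.sqrt 2)⁻¹, (Real.sqrt 2)⁻¹, 0] : EuclideanSpace ℝ (Fin 3)) norm_cPlus ν hν hνlt μ
  rw [sphereForce_cPlus_eq_abc] at key
  exact key hμ hint

end Summit.AnomalousDissipation.AnomalousDissipation.Theorems.BoundedSphereStatistics.Negative

end
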